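import Mathlib
import HarnessLib
import Summits.NavierStokesRegularity.NavierStokesRegularity.Theorems.TypeIQuarterGateScarEnvelopeTypeIForcedTsaiAlgCertG

/-!
# ARM B lane E-exact, Type-I-tail class — a SHARED-EVALUATION form of the v3 check (`AlgRowG.checkGs`), equal to
  `AlgRowG.checkG` by `rfl`, for kernel replay of LARGE witness rows (LANEX-ALG v3, `…ForcedTsaiAlgCertG`)

`AlgRowG.checkG` is written compositionally (`r.toRow.gNF i`, `r.g2Poly`, `r.res2E`, `r.res2O`, `r.toRowF.lev2F`); evaluated
natively this RECOMPUTES the symbolic pipeline many times over (`conv5` — the `(u·∇)u` products — inside every `g`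
component, the `g` components inside `fuel` and again inside each `gNF`, the squared normal form `|gNF|²` once for the even
and once for the odd residual part).  For the 946-monomial larger-basis witness of the ns-wall-extremal cell (eng-3 g2,
j319388) the replay took 982 s on the farm, above the gate's 600 s elaboration budget.  `checkGs` is the SAME Boolean,
restructured with `let`-sharing (each of `u`, `ω`, `f = lin5 u`, `n = conv5 u`, `g`, `fuel`, `gNF`, `|ω|²`, `|gNF|²` computed
once); `AlgRowG.checkGs_eq_checkG : r.checkGs = r.checkG` holds by `rfl` (ζ/δ-reduction and `![a,b,c] i` literals), so a
data module may prove `r.checkGs = true` by `native_decide` and conclude `r.checkG = true`, hence `AlgRowG.sound`.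
No new semantics; nothing about NS regularity.
-/

set_option linter.dupNamespace false

namespace Summit.NavierStokesRegularity.NavierStokesRegularity.Cruxes.ScarEnvelopeTypeI.ForcedTsai

namespace AlgRowG

/-- **Shared-evaluation form of `checkG`** (same value, see `checkGs_eq_checkG`). -/
def checkGs (r : AlgRowG) : Bool :=
  let τ2 : ℚ := r.tau * r.tau
  let u : Fin 3 → Poly5 := curl5 τ2 r.psi
  let u0 := u 0
  let u1 := u 1
  let u2 := u 2
  let uu : Fin 3 → Poly5 := ![u0, u1, u2]
  let om : Fin 3 → Poly5 := curl5 τ2 uu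
  let om0 := om 0
  let om1 := om 1
  let om2 := om 2
  let f : Fin 3 → Poly5 := lin5 τ2 uu
  let f0 := f 0
  let f1 := f 1
  let f2 := f 2
  let n : Fin 3 → Poly5 := conv5 τ2 uu
  let n0 := n 0
  let n1 := n 1
  let n2 := n 2
  let cf : Fin 3 → Poly5 := curl5 τ2 ![f0, f1, f2]
  let cn : Fin 3 → Poly5 := curl5 τ2 ![n0, n1, n2]
  let g0 := Poly5.add (cf 0) (cn 0)
  let g1 := Poly5.add (cf 1) (cn 1)
  let g2 := Poly5.add (cf 2) (cn 2)
  let fuel : ℕ := List.foldl (fun acc m => max acc (m.e3 + 2 * m.et + 2)) 0 (g0 ++ g1 ++ g2)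
  let gn0 := Poly5.norm (Poly5.nf τ2 fuel g0)
  let gn1 := Poly5.norm (Poly5.nf τ2 fuel g1)
  let gn2 := Poly5.norm (Poly5.nf τ2 fuel g2)
  let G : Poly5 := Poly5.add (Poly5.add (Poly5.nmul gn0 gn0) (Poly5.nmul gn1 gn1)) (Poly5.nmul gn2 gn2)
  let OM : Poly5 := Poly5.add (Poly5.add (Poly5.nmul om0 om0) (Poly5.nmul om1 om1)) (Poly5.nmul om2 om2)
  decide (0 < r.tau) && decide (0 ≤ r.M) && decide (0 ≤ r.δ) && r.floor.check r.tau &&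
    (match Poly5.integrate r.tau (Poly5.nmul r.floor.poly OM), Poly5.integrate r.tau (Poly5.nmul weightEven G),
        Poly5.integrateOdd r.tau (Poly5.nmul weightOdd G) with
      | some L, some R, some o => decide (r.M * r.M ≤ encLo L) && decide (encHi (R.1 + o, R.2) ≤ r.δ * r.δ)
      | _, _, _ => false)

/-- The shared form IS the check (definitional: `let`s, `AlgRow.u/om/g/fuel/gNF`, `toRow`/`toRowF`, `![·] i` literals). -/
theorem checkGs_eq_checkG (r : AlgRowG) : r.checkGs = r.checkG := rfl

/-- A row passing the shared form passes `checkG` (so `AlgRowG.sound` applies). -/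
theorem checkG_of_checkGs (r : AlgRowG) (h : r.checkGs = true) : r.checkG = true :=
  (checkGs_eq_checkG r) ▸ h

end AlgRowG

/-- The kernel self-test row of `…AlgCertG` also passes the shared form (same Boolean). -/
example : algRowGSelfTest.checkGs = true := by native_decide

end Summit.NavierStokesRegularity.NavierStokesRegularity.Cruxes.ScarEnvelopeTypeI.ForcedTsai
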